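import Mathlib
import HarnessLib
import Summits.ResolutionOfSingularities.ResolutionOfSingularities.Theorems.WildQuotientsWildQuotientResolutionS1aReesBigrading

/-!
# S1a — (M) MULT-GOOD, part 1: the `ℤ × ι`-GRADING of the Laurent ring `B[T;T⁻¹]` over a graded ring

[OURS · L1 W4.5c · lead-1 g11; plan-1 SIG (M) v2 `Cruxes/CyclicQuotientFourfolds/Lines/W45cMultGoodSig.lean` (646be4e56a48), A-NIL v0 §3, A-KF v0 (O4);
ASSIGNMENT v10.34 «(M) refinement tool»] — NOT statements of the manuscript; counted 0; AI-level work, weaker than expert review. Crux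
stmt-ResolutionOfSingularities-17941 `CyclicQuotientFourfolds`, line `s1a-logminvertex` v12 (`stub_reachLowerInF`): PRODUCER TOOL.

For `B` graded by `𝒜 : ι → AddSubgroup B`, the Laurent ring `B[T;T⁻¹]` is graded by `ℤ × ι` with `deg (C x · Tⁿ) = (n, deg x)` — the pattern of
`…S1aReesBigrading` (there for the cobordant subalgebra) on the whole Laurent ring:
* `laurentPiece 𝒜`, `mem_laurentPiece_iff`, pins `C_mul_T_mem_laurentPiece` / `C_mem_laurentPiece` / `T_mem_laurentPiece`, `coeff_of_mem_laurentPiece`;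
* `laurentPiece_gradedMonoid`, `iSup_laurentPiece_eq_top`, `component`, `iSupIndep_laurentPiece`, `isInternal_laurentPiece`, ★ `laurentGradedRing`;
* `laurentPiece_zero_eq` (degree `0` = `C (𝒜 0)`), `inv_mem_zero_of_mem_zero` / `val_zpow_mem_zero` (a degree-`0` unit has its powers in degree `0`).
-/

set_option linter.dupNamespace false

noncomputable section

open DirectSum Literature.AlgebraicGeometry.Resolution
open scoped LaurentPolynomial
open Summit.ResolutionOfSingularities.ResolutionOfSingularities.Theorems.WildQuotientResolution.S1
open Summit.ResolutionOfSingularities.ResolutionOfSingularities.Theorems.WildQuotientResolution.S1.ReesBigrading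

namespace Summit.ResolutionOfSingularities.ResolutionOfSingularities.Theorems.WildQuotientResolution.S1.MultGood

universe u v

/-! ## The `ℤ × ι`-grading of `B[T;T⁻¹]` -/

section Grading

variable {ι : Type v} {B : Type u} [CommRing B] (𝒜 : ι → AddSubgroup B)

/-- **The Laurent bigrading**: the piece of bidegree `(n, i)` consists of the `C x · Tⁿ` with `x ∈ 𝒜 i`. [OURS · L1 W4.5c · (M)] -/
def laurentPiece (ni : ℤ × ι) : AddSubgroup B[T;T⁻¹] where
  carrier := {q | ∃ x : B, x ∈ 𝒜 ni.2 ∧ q = LaurentPolynomial.C x * LaurentPolynomial.T ni.1}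
  zero_mem' := ⟨0, zero_mem _, by rw [map_zero, zero_mul]⟩
  add_mem' := by
    rintro q q' ⟨x, hx, rfl⟩ ⟨y, hy, rfl⟩
    exact ⟨x + y, add_mem hx hy, by rw [map_add, add_mul]⟩
  neg_mem' := by
    rintro q ⟨x, hx, rfl⟩
    exact ⟨-x, neg_mem hx, by rw [map_neg, neg_mul]⟩

/-- Normal form of the elements of a piece. -/
theorem mem_laurentPiece_iff {ni : ℤ × ι} {q : B[T;T⁻¹]} :
    q ∈ laurentPiece 𝒜 ni ↔ ∃ x : B, x ∈ 𝒜 ni.2 ∧ q = LaurentPolynomial.C x * LaurentPolynomial.T ni.1 :=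
  Iff.rfl

/-- PIN: `C x · Tⁿ` has bidegree `(n, deg x)`. -/
theorem C_mul_T_mem_laurentPiece {x : B} {i : ι} (hx : x ∈ 𝒜 i) (n : ℤ) :
    LaurentPolynomial.C x * LaurentPolynomial.T n ∈ laurentPiece 𝒜 (n, i) :=
  ⟨x, hx, rfl⟩

/-- PIN: `C x` has bidegree `(0, deg x)`. -/
theorem C_mem_laurentPiece {x : B} {i : ι} (hx : x ∈ 𝒜 i) : LaurentPolynomial.C x ∈ laurentPiece 𝒜 (0, i) :=
  ⟨x, hx, by rw [LaurentPolynomial.T_zero, mul_one]⟩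

/-- The coefficients of an element of the piece `(n, i)`: `x` in degree `n`, `0` elsewhere. -/
theorem coeff_of_mem_laurentPiece {ni : ℤ × ι} {q : B[T;T⁻¹]} (hq : q ∈ laurentPiece 𝒜 ni) (m : ℤ) :
    q.coeff m ∈ 𝒜 ni.2 ∧ (m ≠ ni.1 → q.coeff m = 0) := by
  obtain ⟨x, hx, rfl⟩ := hq
  rw [coeff_C_mul_T]
  split_ifs with h
  · exact ⟨hx, fun hm => absurd h.symm hm⟩
  · exact ⟨zero_mem _, fun _ => rfl⟩

variable [AddCommGroup ι] [DecidableEq ι] [GradedRing 𝒜]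

/-- PIN: `Tⁿ` has bidegree `(n, 0)`. -/
theorem T_mem_laurentPiece (n : ℤ) : (LaurentPolynomial.T n : B[T;T⁻¹]) ∈ laurentPiece 𝒜 (n, 0) :=
  ⟨1, SetLike.one_mem_graded 𝒜, by rw [map_one, one_mul]⟩

/-- The pieces form a graded monoid. -/
theorem laurentPiece_gradedMonoid : SetLike.GradedMonoid (laurentPiece 𝒜) where
  one_mem := ⟨1, SetLike.one_mem_graded 𝒜, by rw [map_one, one_mul, Prod.fst_zero, LaurentPolynomial.T_zero]⟩
  mul_mem := by
    rintro ⟨n, i⟩ ⟨m, j⟩ q q' ⟨x, hx, rfl⟩ ⟨y, hy, rfl⟩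
    refine ⟨x * y, SetLike.mul_mem_graded hx hy, ?_⟩
    rw [Prod.fst_add, map_mul, LaurentPolynomial.T_add]
    ring

/-- **The pieces span `B[T;T⁻¹]`** (`q = Σₙ Σᵢ C (coeff q n)ᵢ · Tⁿ`). -/
theorem iSup_laurentPiece_eq_top : ⨆ ni, laurentPiece 𝒜 ni = ⊤ := by
  classical
  rw [eq_top_iff]
  rintro q -
  have hq : q = ∑ n ∈ q.coeff.support, ∑ i ∈ (DirectSum.decompose 𝒜 (q.coeff n)).support,
      LaurentPolynomial.C (DirectSum.decompose 𝒜 (q.coeff n) i : B) * LaurentPolynomial.T n := by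
    conv_lhs => rw [eq_sum_C_mul_T q]
    refine Finset.sum_congr rfl fun n _ => ?_
    rw [← Finset.sum_mul, ← map_sum, DirectSum.sum_support_decompose 𝒜]
  rw [hq]
  refine AddSubgroup.sum_mem _ fun n _ => AddSubgroup.sum_mem _ fun i _ => AddSubgroup.mem_iSup_of_mem (n, i) ?_
  exact ⟨_, (DirectSum.decompose 𝒜 _ i).2, rfl⟩

/-- The functional `q ↦ ((coeff q n)ᵢ : B)` reading the bidegree-`(n, i)` component. -/
def component (n : ℤ) (i : ι) : B[T;T⁻¹] →+ B where
  toFun q := (DirectSum.decompose 𝒜 (q.coeff n) i : B)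
  map_zero' := by simp
  map_add' q q' := by
    simp only [AddMonoidAlgebra.coeff_add, Finsupp.add_apply, DirectSum.decompose_add, DirectSum.add_apply, AddMemClass.coe_add]

/-- The functional of bidegree `(n, i)` kills every other piece. -/
theorem component_eq_zero_of_mem {n : ℤ} {i : ι} {nj : ℤ × ι} (hne : nj ≠ (n, i)) {q : B[T;T⁻¹]} (hq : q ∈ laurentPiece 𝒜 nj) :
    component 𝒜 n i q = 0 := by
  obtain ⟨x, hx, rfl⟩ := hq
  change (DirectSum.decompose 𝒜 ((LaurentPolynomial.C x * LaurentPolynomial.T nj.1).coeff n) i : B) = 0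
  rw [coeff_C_mul_T]
  split_ifs with h
  · refine DirectSum.decompose_of_mem_ne 𝒜 hx fun h' => hne ?_
    ext <;> simp [h, h']
  · simp

/-- On its own piece the functional recovers the coefficient. -/
theorem component_eq_of_mem {n : ℤ} {i : ι} {x : B} (hx : x ∈ 𝒜 i) :
    component 𝒜 n i (LaurentPolynomial.C x * LaurentPolynomial.T n) = x := by
  change (DirectSum.decompose 𝒜 ((LaurentPolynomial.C x * LaurentPolynomial.T n).coeff n) i : B) = x
  rw [coeff_C_mul_T, if_pos rfl, DirectSum.decompose_of_mem_same 𝒜 hx]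

/-- **The pieces are independent.** -/
theorem iSupIndep_laurentPiece : iSupIndep (laurentPiece 𝒜) := by
  classical
  rintro ⟨n, i⟩
  rw [disjoint_iff_inf_le]
  rintro q ⟨hq₁, hq₂⟩
  have h0 : component 𝒜 n i q = 0 := by
    refine AddSubgroup.iSup_induction (fun nj => ⨆ (_ : nj ≠ (n, i)), laurentPiece 𝒜 nj)
      (C := fun q' => component 𝒜 n i q' = 0) hq₂ ?_ (map_zero _) ?_
    · intro nj q' hq'
      by_cases hnj : nj = (n, i)
      · subst hnj
        rw [iSup_neg (fun h => h rfl), AddSubgroup.mem_bot] at hq'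
        rw [hq', map_zero]
      · rw [iSup_pos hnj] at hq'
        exact component_eq_zero_of_mem 𝒜 hnj hq'
    · intro q₁ q₂ h₁ h₂
      rw [map_add, h₁, h₂, add_zero]
  obtain ⟨x, hx, rfl⟩ := hq₁
  rw [component_eq_of_mem 𝒜 hx] at h0
  rw [AddSubgroup.mem_bot, h0, map_zero, zero_mul]

/-- The decomposition is internal. -/
theorem isInternal_laurentPiece : DirectSum.IsInternal (laurentPiece 𝒜) := by
  classical
  refine ⟨(iSupIndep_laurentPiece 𝒜).dfinsuppSumAddHom_injective, fun q => ?_⟩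
  have hq : q ∈ ⨆ ni, laurentPiece 𝒜 ni := by rw [iSup_laurentPiece_eq_top 𝒜]; trivial
  refine AddSubgroup.iSup_induction (laurentPiece 𝒜) (C := fun y => ∃ z, DirectSum.coeAddMonoidHom (laurentPiece 𝒜) z = y) hq
    (fun e y hy => ⟨DirectSum.of (fun ni => ↥(laurentPiece 𝒜 ni)) e ⟨y, hy⟩, DirectSum.coeAddMonoidHom_of (laurentPiece 𝒜) _ _⟩)
    ⟨0, (DirectSum.coeAddMonoidHom (laurentPiece 𝒜)).map_zero⟩ ?_
  rintro _ _ ⟨z₁, rfl⟩ ⟨z₂, rfl⟩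
  exact ⟨z₁ + z₂, (DirectSum.coeAddMonoidHom (laurentPiece 𝒜)).map_add z₁ z₂⟩

/-- **`B[T;T⁻¹]` is a `ℤ × ι`-graded ring.** [OURS · L1 W4.5c · (M)] -/
@[implicit_reducible]
def laurentGradedRing : GradedRing (laurentPiece 𝒜) :=
  { laurentPiece_gradedMonoid 𝒜 with
    toDecomposition := (isInternal_laurentPiece 𝒜).chooseDecomposition }

omit [DecidableEq ι] [GradedRing 𝒜] in
/-- **Degree `0` of the Laurent node = `C (𝒜 0)`.** -/
theorem laurentPiece_zero_eq : laurentPiece 𝒜 0 = (𝒜 0).map (LaurentPolynomial.C : B →+* B[T;T⁻¹]).toAddMonoidHom := by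
  ext q
  rw [mem_laurentPiece_iff, AddSubgroup.mem_map]
  constructor
  · rintro ⟨x, hx, rfl⟩
    exact ⟨x, hx, by rw [Prod.fst_zero, LaurentPolynomial.T_zero, mul_one]; rfl⟩
  · rintro ⟨x, hx, rfl⟩
    exact ⟨x, hx, by rw [Prod.fst_zero, LaurentPolynomial.T_zero, mul_one]; rfl⟩

/-- A degree-`0` UNIT of a graded ring has its inverse in degree `0`. -/
theorem inv_mem_zero_of_mem_zero (u : Bˣ) (hu : (u : B) ∈ 𝒜 0) : (↑u⁻¹ : B) ∈ 𝒜 0 := by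
  classical
  -- the degree-0 component `v₀` of `v = u⁻¹` is already an inverse
  set v : B := ↑u⁻¹ with hv
  have huv : (u : B) * v = 1 := by rw [hv, Units.mul_inv]
  have h0 : (u : B) * (DirectSum.decompose 𝒜 v 0 : B) = 1 := by
    have := congrArg (fun b => (DirectSum.decompose 𝒜 b 0 : B)) huv
    simp only at this
    rw [DirectSum.decompose_of_mem_same 𝒜 (SetLike.one_mem_graded 𝒜)] at this
    rw [← this, DirectSum.coe_decompose_mul_of_left_mem_zero 𝒜 hu]
  have : v = (DirectSum.decompose 𝒜 v 0 : B) := by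
    calc v = v * ((u : B) * (DirectSum.decompose 𝒜 v 0 : B)) := by rw [h0, mul_one]
      _ = (v * (u : B)) * (DirectSum.decompose 𝒜 v 0 : B) := by rw [mul_assoc]
      _ = (DirectSum.decompose 𝒜 v 0 : B) := by rw [hv, Units.inv_mul, one_mul]
  rw [this]
  exact (DirectSum.decompose 𝒜 v 0).2

/-- Integer powers of a degree-`0` unit have degree `0`. -/
theorem val_zpow_mem_zero (u : Bˣ) (hu : (u : B) ∈ 𝒜 0) (n : ℤ) : ((u ^ n : Bˣ) : B) ∈ 𝒜 0 := by
  cases n with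
  | ofNat k =>
    rw [Int.ofNat_eq_natCast, zpow_natCast, Units.val_pow_eq_pow_val]
    have := SetLike.pow_mem_graded k hu
    rwa [nsmul_zero] at this
  | negSucc k =>
    rw [zpow_negSucc, ← inv_pow, Units.val_pow_eq_pow_val]
    have := SetLike.pow_mem_graded (k + 1) (inv_mem_zero_of_mem_zero 𝒜 u hu)
    rwa [nsmul_zero] at this

end Grading

end Summit.ResolutionOfSingularities.ResolutionOfSingularities.Theorems.WildQuotientResolution.S1.MultGood

end
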